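import Summits.HubbardSuperconductivity.HubbardLadder.NeelDiagonalMajorantR1
import Summits.HubbardSuperconductivity.HubbardLadder.NeelDiagonalMajorantR2
import Summits.HubbardSuperconductivity.HubbardSuperconductivity.Theorems.MesoscopicPairOrder.Negative.StonerOcticBand
import HarnessLib

/-!
# Device D35: an `L`-UNIFORM lower bound on the diagonal-neighbour correlation of the spin-½
# square-lattice Heisenberg antiferromagnet (HubbardLadder R2, H₀ line)

HONEST FRAMING: ladder R1–R4 with certified numbers; no claim on H/H₀.

THE RESULT (`heisRedCorr2_diag_lower_uniform`). For every even torus side `L = 2k ≥ 8`, the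
ground-state diagonal correlation `c_L(1,1) = Re ω(Sᶻ_0 Sᶻ_(1,1))` of `Σ_⟨xy⟩ 𝐒_x·𝐒_y` on `(ℤ/Lℤ)²`
(spin ½; the tree's `Literature.MathematicalPhysics.QuantumLattice.heisRedCorr2 L 1 1 1`, tracial
ground-state functional) satisfies `c_L(1,1) ≥ 21/256 - 𝓦̄²/5 = 285532264975191/22517998136852480 ≥ 0.0126`
(`𝓦̄ = 39517683/67108864`): the NÉEL SIGN of the next-nearest-neighbour correlation, with an `L`-independent margin, as
a kernel theorem generic in `L`. What is imported from the literature is exactly the tree's generic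
three-sum-rule inequality `heisRedCorr2_diag_lower_energyFree` (Kennedy–Lieb–Shastry 1988, eqs. (1)–(3),
(6)–(9) with the diagonal sum rule; file `HeisenbergOrderNeelDiagonalSumRule.lean`):
`-t/4 - 𝓦(L)²/(8b) ≤ c_L(1,1)` whenever `K(Q) = 1 - b + t ≥ 0`, `b > 0`, where
`𝓦(L) = L⁻² Σ_{q ≠ Q} max(-K(q),0) (E_q/E_{q-Q})^(1/2)` (`klsDiagRiemannSum 1 b t L`).

THE NEW INPUT (this file + `NeelDiagonalMajorantR1/R2.lean`): at `b = 5/8`, `t = -21/64` the bounded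
integrand `F(q) = max(-K,0)(E_q/E_{q-Q})^(1/2)` is dominated pointwise on the whole dual torus minus `Q`
by the trigonometric polynomial `M = ((u-v)²/4) R₁(u+v) + R₂(u+v)` (`u = cos q₀`, `v = cos q₁`;
`klsMajorant_pointwise`, four `s = u+v` regimes glued from the six certified one-variable polynomial
inequalities), and `M` has single-variable degree `≤ 6 < L`, so its lattice average is computed EXACTLY
by character orthogonality (`sum_klsCosProd_eq_zero`: `Σ_q cos(m q₀) cos(m' q₁) = 0` for
`(m, m') ≠ (0, 0)`, `m, m' < L`) from the product-to-sum expansion `klsM_cos_expand` — it is the same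
dyadic rational `𝓦̄` for every `L ≥ 8` (`sum_klsM`). Hence `𝓦(L) ≤ 𝓦̄` (`klsDiagRiemannSum_le_uniform`)
and the bound follows by monotonicity in `𝓦`. No named fact, no numerical evaluation of a special
function: every constant is a rational checked by `norm_num`/`ring`. (A Riemann-sum/modulus-of-continuity
treatment of `𝓦(L) → ∫ F` would give `≈ 0.0207` asymptotically; the polynomial majorant trades the last
40% of the constant for an `L`-uniform kernel proof.) Numerics and certificates:
`pub-hubbard-r2/rplp/d35/num/` (`final_cert.py`, `nu_table.py`, `gen_u1.py`, `gen_u2.py`).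
[cite: KLS1988JSP, eqs. (1)-(3), (6)-(9)] [folklore: Chebyshev expansion, character orthogonality]
-/

noncomputable section

open Finset Literature.MathematicalPhysics.QuantumLattice Literature.Probability.LatticeModels

namespace Summit.HubbardSuperconductivity.HubbardLadder

/-! ### Multiple-angle formulas `cos(mx)` as polynomials in `cos x`, `m = 4, 5, 6`

These are the landed tree lemmas `cos_four_mul_eq`, `cos_five_mul_eq`, `cos_six_mul_eq` of
`Summits.HubbardSuperconductivity.HubbardSuperconductivity.Theorems.MesoscopicPairOrder.Negative.StonerOcticBand`
(reused by import; the filer's `dedup.landed` edit of LEAN FILING REQUEST #178.3 — no statement of this file changed). -/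

/-! ### Character orthogonality for the products `cos(m q₀) cos(m' q₁)` on the square dual torus -/

/-- `cos(m q₀) cos(m' q₁)` at the dual-torus point `q` of side `L`. [folklore] -/
def klsCosProd (L m m' : ℕ) (q : TorusSite 2 L) : ℝ :=
  Real.cos ((m : ℝ) * latticeMomentum L q 0) * Real.cos ((m' : ℝ) * latticeMomentum L q 1)

/-- `Σ_q cos(m q₀) cos(m' q₁) = 0` for `(m, m') ≠ (0, 0)`, `m, m' < L` (product-to-sum through the
characters of `(ℤ/Lℤ)²`, then `Σ_q cos(q·w) = L² δ_(w,0)`). [folklore] -/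
theorem sum_klsCosProd_eq_zero (L : ℕ) [NeZero L] (m m' : ℕ) (hm : m < L) (hm' : m' < L)
    (h : ¬(m = 0 ∧ m' = 0)) : ∑ q : TorusSite 2 L, klsCosProd L m m' q = 0 := by
  have hm0 : ((m : ℕ) : ZMod L) = 0 → m = 0 := fun e =>
    Nat.eq_zero_of_dvd_of_lt ((ZMod.natCast_eq_zero_iff m L).1 e) hm
  have hm0' : ((m' : ℕ) : ZMod L) = 0 → m' = 0 := fun e =>
    Nat.eq_zero_of_dvd_of_lt ((ZMod.natCast_eq_zero_iff m' L).1 e) hm'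
  have h01 : (0 : Fin 2) ≠ 1 := by decide
  have hne1 : (Pi.single (0 : Fin 2) ((m : ℕ) : ZMod L) + Pi.single 1 ((m' : ℕ) : ZMod L) :
      TorusSite 2 L) ≠ 0 := by
    intro hw
    have e0 := congr_fun hw 0
    have e1 := congr_fun hw 1
    simp only [Pi.add_apply, Pi.single_eq_same, Pi.single_eq_of_ne h01, Pi.single_eq_of_ne h01.symm,
      add_zero, zero_add, Pi.zero_apply] at e0 e1
    exact h ⟨hm0 e0, hm0' e1⟩
  have hne2 : (Pi.single (0 : Fin 2) ((m : ℕ) : ZMod L) - Pi.single 1 ((m' : ℕ) : ZMod L) :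
      TorusSite 2 L) ≠ 0 := by
    intro hw
    have e0 := congr_fun hw 0
    have e1 := congr_fun hw 1
    simp only [Pi.sub_apply, Pi.single_eq_same, Pi.single_eq_of_ne h01, Pi.single_eq_of_ne h01.symm,
      sub_zero, zero_sub, neg_eq_zero, Pi.zero_apply] at e0 e1
    exact h ⟨hm0 e0, hm0' e1⟩
  simp_rw [klsCosProd, cos_natCast_mul_latticeMomentum, cos_torusPhase_mul_cos_torusPhase]
  rw [← sum_div, sum_add_distrib, sum_cos_torusPhase, sum_cos_torusPhase, if_neg hne1, if_neg hne2]
  norm_num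

/-- `|(ℤ/Lℤ)²| = L²`. [folklore] -/
private theorem card_torusSite_two_cast (L : ℕ) [NeZero L] :
    (Fintype.card (TorusSite 2 L) : ℝ) = (L : ℝ) ^ 2 := by
  rw [Fintype.card_pi, prod_const, ZMod.card, card_univ, Fintype.card_fin]
  push_cast
  ring

/-! ### The majorant `M` and its exact lattice average -/

/-- The polynomial majorant `M(u,v) = ((u-v)²/4) R₁(u+v) + R₂(u+v)`.
HONEST FRAMING: ladder R1–R4 with certified numbers; no claim on H/H₀. -/
def klsM (u v : ℝ) : ℝ := (u - v) ^ 2 / 4 * klsR1 (u + v) + klsR2 (u + v)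

/-- `M ≥ 0` on `[-1,1]²` (indeed whenever `u + v ∈ [-2, 2]`). [folklore] -/
theorem klsM_nonneg {u v : ℝ} (h1 : -2 ≤ u + v) (h2 : u + v ≤ 2) : 0 ≤ klsM u v :=
  add_nonneg (mul_nonneg (by positivity) (klsR1_nonneg _ h1 h2)) (klsR2_nonneg _ h1 h2)

/-- The oscillatory part of `M(cos q₀, cos q₁)` in the basis `cos(m q₀) cos(m' q₁)`,
`(m, m') ≠ (0, 0)`, `m + m' ≤ 6` (27 terms; table `nu_4_6.json`). [folklore] -/
def klsOsc (L : ℕ) (q : TorusSite 2 L) : ℝ :=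
    (-65553161/268435456) * klsCosProd L 0 1 q + 109722041/1073741824 * klsCosProd L 0 2 q +
    (-8578479/1073741824) * klsCosProd L 0 3 q + (-15271/8388608) * klsCosProd L 0 4 q +
    (-3022407/1073741824) * klsCosProd L 0 5 q + 662081/1073741824 * klsCosProd L 0 6 q +
    (-65553161/268435456) * klsCosProd L 1 0 q + (-73246823/134217728) * klsCosProd L 1 1 q +
    63006787/268435456 * klsCosProd L 1 2 q + (-10176037/268435456) * klsCosProd L 1 3 q +
    (-4473495/536870912) * klsCosProd L 1 4 q + (-95483/268435456) * klsCosProd L 1 5 q +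
    109722041/1073741824 * klsCosProd L 2 0 q + 63006787/268435456 * klsCosProd L 2 1 q +
    (-290443/4194304) * klsCosProd L 2 2 q + 845775/268435456 * klsCosProd L 2 3 q +
    (-6722593/536870912) * klsCosProd L 2 4 q + (-8578479/1073741824) * klsCosProd L 3 0 q +
    (-10176037/268435456) * klsCosProd L 3 1 q + 845775/268435456 * klsCosProd L 3 2 q +
    (-2934773/134217728) * klsCosProd L 3 3 q + (-15271/8388608) * klsCosProd L 4 0 q +
    (-4473495/536870912) * klsCosProd L 4 1 q + (-6722593/536870912) * klsCosProd L 4 2 q +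
    (-3022407/1073741824) * klsCosProd L 5 0 q + (-95483/268435456) * klsCosProd L 5 1 q +
    662081/1073741824 * klsCosProd L 6 0 q

/-- **Chebyshev expansion of the majorant**: `M(cos q₀, cos q₁) = 𝓦̄ + (oscillatory part)` with the
constant term `𝓦̄ = 39517683/67108864`. [folklore] -/
theorem klsM_cos_expand (L : ℕ) (q : TorusSite 2 L) :
    klsM (Real.cos (latticeMomentum L q 0)) (Real.cos (latticeMomentum L q 1)) =
      39517683/67108864 + klsOsc L q := by
  simp only [klsM, klsR1, klsR2, klsOsc, klsCosProd, Nat.cast_zero, Nat.cast_one, Nat.cast_ofNat, zero_mul,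
    one_mul, Real.cos_zero, Real.cos_two_mul, Real.cos_three_mul, Summit.HubbardSuperconductivity.HubbardSuperconductivity.Theorems.MesoscopicPairOrder.Negative.cos_four_mul_eq,
    Summit.HubbardSuperconductivity.HubbardSuperconductivity.Theorems.MesoscopicPairOrder.Negative.cos_five_mul_eq,
    Summit.HubbardSuperconductivity.HubbardSuperconductivity.Theorems.MesoscopicPairOrder.Negative.cos_six_mul_eq]
  ring

/-- The oscillatory part averages to zero on every torus of side `L ≥ 7` (all frequencies `≤ 6 < L`).
[folklore] -/
theorem sum_klsOsc (L : ℕ) [NeZero L] (hL : 7 ≤ L) : ∑ q : TorusSite 2 L, klsOsc L q = 0 := by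
  have hz : ∀ m m' : ℕ, m ≤ 6 → m' ≤ 6 → ¬(m = 0 ∧ m' = 0) →
      ∑ q : TorusSite 2 L, klsCosProd L m m' q = 0 :=
    fun m m' h1 h2 h3 => sum_klsCosProd_eq_zero L m m' (by omega) (by omega) h3
  simp only [klsOsc, sum_add_distrib, ← mul_sum]
  rw [hz 0 1 (by norm_num) (by norm_num) (by norm_num),
    hz 0 2 (by norm_num) (by norm_num) (by norm_num),
    hz 0 3 (by norm_num) (by norm_num) (by norm_num),
    hz 0 4 (by norm_num) (by norm_num) (by norm_num),
    hz 0 5 (by norm_num) (by norm_num) (by norm_num),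
    hz 0 6 (by norm_num) (by norm_num) (by norm_num),
    hz 1 0 (by norm_num) (by norm_num) (by norm_num),
    hz 1 1 (by norm_num) (by norm_num) (by norm_num),
    hz 1 2 (by norm_num) (by norm_num) (by norm_num),
    hz 1 3 (by norm_num) (by norm_num) (by norm_num),
    hz 1 4 (by norm_num) (by norm_num) (by norm_num),
    hz 1 5 (by norm_num) (by norm_num) (by norm_num),
    hz 2 0 (by norm_num) (by norm_num) (by norm_num),
    hz 2 1 (by norm_num) (by norm_num) (by norm_num),
    hz 2 2 (by norm_num) (by norm_num) (by norm_num),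
    hz 2 3 (by norm_num) (by norm_num) (by norm_num),
    hz 2 4 (by norm_num) (by norm_num) (by norm_num),
    hz 3 0 (by norm_num) (by norm_num) (by norm_num),
    hz 3 1 (by norm_num) (by norm_num) (by norm_num),
    hz 3 2 (by norm_num) (by norm_num) (by norm_num),
    hz 3 3 (by norm_num) (by norm_num) (by norm_num),
    hz 4 0 (by norm_num) (by norm_num) (by norm_num),
    hz 4 1 (by norm_num) (by norm_num) (by norm_num),
    hz 4 2 (by norm_num) (by norm_num) (by norm_num),
    hz 5 0 (by norm_num) (by norm_num) (by norm_num),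
    hz 5 1 (by norm_num) (by norm_num) (by norm_num),
    hz 6 0 (by norm_num) (by norm_num) (by norm_num)]
  norm_num

/-- **The lattice average of the majorant is `𝓦̄` for every side `L ≥ 7`** (in particular for every
even side `L ≥ 8`). [folklore] -/
theorem sum_klsM (L : ℕ) [NeZero L] (hL : 7 ≤ L) :
    ∑ q : TorusSite 2 L, klsM (Real.cos (latticeMomentum L q 0)) (Real.cos (latticeMomentum L q 1)) =
      ((L : ℝ)) ^ 2 * (39517683/67108864) := by
  simp_rw [klsM_cos_expand]
  rw [sum_add_distrib, sum_klsOsc L hL, add_zero, sum_const, card_univ, nsmul_eq_mul,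
    card_torusSite_two_cast]

/-! ### The pointwise domination `F ≤ M` -/

/-- `X ((2-s)/(2+s))^(1/2) ≤ Y` from `X, Y ≥ 0`, `2 + s > 0` and `X²(2-s) ≤ Y²(2+s)`. [folklore] -/
theorem mul_sqrt_div_le {X Y s : ℝ} (hX : 0 ≤ X) (hY : 0 ≤ Y) (hs : 0 < 2 + s)
    (h : X ^ 2 * (2 - s) ≤ Y ^ 2 * (2 + s)) : X * Real.sqrt ((2 - s) / (2 + s)) ≤ Y := by
  calc X * Real.sqrt ((2 - s) / (2 + s))
      = Real.sqrt (X ^ 2 * ((2 - s) / (2 + s))) := by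
        rw [Real.sqrt_mul (sq_nonneg X), Real.sqrt_sq hX]
    _ ≤ Real.sqrt (Y ^ 2) := Real.sqrt_le_sqrt (by rw [← mul_div_assoc, div_le_iff₀ hs]; exact h)
    _ = Y := Real.sqrt_sq hY

/-- **Pointwise majorant.** For `u, v ∈ [-1, 1]` with `u + v > -2` (every dual-torus point but `Q`):
`max(-K,0) ((2-(u+v))/(2+(u+v)))^(1/2) ≤ M(u,v)`, `K = uv + 5(u+v)/16 - 21/64`. Four regimes in
`s = u + v`: on `(-2, -31/16]` and `[11/16, 2]` the `s`-part `A(s)` of `-K` is `≤ 0`; on the two middle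
ranges `max(-K,0) ≤ (u-v)²/4 + (A(s) + 5/1024)`; the square root is absorbed by `R₁` (`s ≥ -29/16`) or by
`(u-v)² ≤ (2+s)²` (`s ≤ -29/16`), and the `s`-parts by the three certified `R₂` pieces.
HONEST FRAMING: ladder R1–R4 with certified numbers; no claim on H/H₀. [folklore] -/
theorem klsMajorant_pointwise {u v : ℝ} (hu1 : -1 ≤ u) (hu2 : u ≤ 1) (hv1 : -1 ≤ v) (hv2 : v ≤ 1)
    (hs0 : -2 < u + v) :
    max (-(u * v + 5 / 8 * ((u + v) / 2) + -(21 / 64))) 0 * Real.sqrt ((2 - (u + v)) / (2 + (u + v)))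
      ≤ klsM u v := by
  unfold klsM
  have hK : -(u * v + 5 / 8 * ((u + v) / 2) + -(21 / 64)) = (u - v) ^ 2 / 4 + klsA (u + v) := by
    unfold klsA; ring
  rw [hK]
  set s := u + v with hs_def
  have hs2 : s ≤ 2 := by linarith
  have hpos : 0 < 2 + s := by linarith
  have hw : (u - v) ^ 2 ≤ (2 + s) ^ 2 := by
    nlinarith [mul_nonneg (show (0:ℝ) ≤ 1 + u by linarith) (show (0:ℝ) ≤ 1 + v by linarith)]
  have hw0 : 0 ≤ (u - v) ^ 2 / 4 := by positivity
  have hR1 := klsR1_nonneg s hs0.le hs2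
  have hR2 := klsR2_nonneg s hs0.le hs2
  have hsq := Real.sqrt_nonneg ((2 - s) / (2 + s))
  have hA : klsA s = -5 / 1024 - (s + 31 / 16) * (s - 11 / 16) / 4 := by unfold klsA; ring
  have hA0 : klsA (-31/16) = -5 / 1024 := by unfold klsA; norm_num
  have hA3 : klsA (11/16) = -5 / 1024 := by unfold klsA; norm_num
  rcases le_total s (-31/16 : ℝ) with h1 | h1
  · -- regime 1: `A ≤ 0`, `(u-v)² ≤ (2+s)²`, piece 1
    have hAneg : klsA s ≤ 0 := by
      rw [hA]; nlinarith [mul_nonneg (show (0:ℝ) ≤ -(s + 31 / 16) by linarith)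
        (show (0:ℝ) ≤ -(s - 11 / 16) by linarith)]
    have hmax : max ((u - v) ^ 2 / 4 + klsA s) 0 ≤ (2 + s) ^ 2 / 4 :=
      max_le (by linarith) (by positivity)
    have cert := klsR2_piece1_sub_nonneg s hs0.le h1
    calc max ((u - v) ^ 2 / 4 + klsA s) 0 * Real.sqrt ((2 - s) / (2 + s))
        ≤ (2 + s) ^ 2 / 4 * Real.sqrt ((2 - s) / (2 + s)) := mul_le_mul_of_nonneg_right hmax hsq
      _ ≤ klsR2 s := mul_sqrt_div_le (by positivity) hR2 hpos (by nlinarith [mul_nonneg hpos.le cert])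
      _ ≤ (u - v) ^ 2 / 4 * klsR1 s + klsR2 s := le_add_of_nonneg_left (mul_nonneg hw0 hR1)
  rcases le_total s (-29/16 : ℝ) with h2 | h2
  · -- regime 2: `max(-K,0) ≤ (2+s)²/4 + A - A(-31/16)`, piece 2
    have hP0 : 0 ≤ (2 + s) ^ 2 / 4 + klsA s - klsA (-31/16) := by
      rw [hA, hA0]; nlinarith [mul_nonneg (show (0:ℝ) ≤ s + 31 / 16 by linarith)
        (show (0:ℝ) ≤ -(s - 11 / 16) by linarith), sq_nonneg (2 + s)]
    have hmax : max ((u - v) ^ 2 / 4 + klsA s) 0 ≤ (2 + s) ^ 2 / 4 + klsA s - klsA (-31/16) :=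
      max_le (by rw [hA0]; linarith) hP0
    have cert := klsR2_piece2_sub_nonneg s h1 h2
    calc max ((u - v) ^ 2 / 4 + klsA s) 0 * Real.sqrt ((2 - s) / (2 + s))
        ≤ ((2 + s) ^ 2 / 4 + klsA s - klsA (-31/16)) * Real.sqrt ((2 - s) / (2 + s)) :=
          mul_le_mul_of_nonneg_right hmax hsq
      _ ≤ klsR2 s := mul_sqrt_div_le hP0 hR2 hpos (by linarith)
      _ ≤ (u - v) ^ 2 / 4 * klsR1 s + klsR2 s := le_add_of_nonneg_left (mul_nonneg hw0 hR1)
  -- `s ≥ -29/16`: the square root is absorbed by `R₁`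
  have hroot : Real.sqrt ((2 - s) / (2 + s)) ≤ klsR1 s := by
    have c1 := klsR1_sq_sub_nonneg s h2 hs2
    have := mul_sqrt_div_le zero_le_one hR1 hpos (by linarith)
    simpa using this
  rcases le_total s (11/16 : ℝ) with h3 | h3
  · -- regime 3: `max(-K,0) ≤ (u-v)²/4 + (A - A(11/16))`, `R₁` and piece 3
    have hP0 : 0 ≤ klsA s - klsA (11/16) := by
      rw [hA, hA3]; nlinarith [mul_nonneg (show (0:ℝ) ≤ s + 31 / 16 by linarith)
        (show (0:ℝ) ≤ -(s - 11 / 16) by linarith)]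
    have hmax : max ((u - v) ^ 2 / 4 + klsA s) 0 ≤ (u - v) ^ 2 / 4 + (klsA s - klsA (11/16)) :=
      max_le (by rw [hA3]; linarith) (add_nonneg hw0 hP0)
    have cert := klsR2_piece3_sub_nonneg s h2 h3
    calc max ((u - v) ^ 2 / 4 + klsA s) 0 * Real.sqrt ((2 - s) / (2 + s))
        ≤ ((u - v) ^ 2 / 4 + (klsA s - klsA (11/16))) * Real.sqrt ((2 - s) / (2 + s)) :=
          mul_le_mul_of_nonneg_right hmax hsq
      _ = (u - v) ^ 2 / 4 * Real.sqrt ((2 - s) / (2 + s)) +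
            (klsA s - klsA (11/16)) * Real.sqrt ((2 - s) / (2 + s)) := by ring
      _ ≤ (u - v) ^ 2 / 4 * klsR1 s + klsR2 s :=
          add_le_add (mul_le_mul_of_nonneg_left hroot hw0) (mul_sqrt_div_le hP0 hR2 hpos (by linarith))
  · -- regime 4: `A ≤ 0`, `R₁`
    have hAneg : klsA s ≤ 0 := by
      rw [hA]; nlinarith [mul_nonneg (show (0:ℝ) ≤ s + 31 / 16 by linarith)
        (show (0:ℝ) ≤ s - 11 / 16 by linarith)]
    have hmax : max ((u - v) ^ 2 / 4 + klsA s) 0 ≤ (u - v) ^ 2 / 4 := max_le (by linarith) hw0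
    calc max ((u - v) ^ 2 / 4 + klsA s) 0 * Real.sqrt ((2 - s) / (2 + s))
        ≤ (u - v) ^ 2 / 4 * Real.sqrt ((2 - s) / (2 + s)) := mul_le_mul_of_nonneg_right hmax hsq
      _ ≤ (u - v) ^ 2 / 4 * klsR1 s := mul_le_mul_of_nonneg_left hroot hw0
      _ ≤ (u - v) ^ 2 / 4 * klsR1 s + klsR2 s := le_add_of_nonneg_right hR2

/-- **The lattice summand is dominated by `M`** at every dual-torus point `q ≠ Q` of an even torus
(`E_q = 2 - (u+v)`, `E_(q-Q) = 2 + (u+v) > 0`). [cite: KLS1988JSP, eqs. (1), (4), (6)-(9)] -/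
theorem klsDiag_summand_le (k : ℕ) (hk : 1 ≤ k) (q : TorusSite 2 (2 * k))
    (hq : q ≠ neelIndex (2 * k)) :
    max (-klsDiagKernel 1 (5 / 8) (-(21 / 64)) (2 * k) q) 0 *
        Real.sqrt (dispersion (latticeMomentum (2 * k) q) /
          dispersion (latticeMomentum (2 * k) (q - neelIndex (2 * k)))) ≤
      klsM (Real.cos (latticeMomentum (2 * k) q 0)) (Real.cos (latticeMomentum (2 * k) q 1)) := by
  haveI : NeZero (2 * k) := ⟨by omega⟩
  have hC : torusCosSum (2 * k) q =
      Real.cos (latticeMomentum (2 * k) q 0) + Real.cos (latticeMomentum (2 * k) q 1) := by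
    simp [torusCosSum, Fin.sum_univ_two]
  have hE1 : dispersion (latticeMomentum (2 * k) q) =
      2 - (Real.cos (latticeMomentum (2 * k) q 0) + Real.cos (latticeMomentum (2 * k) q 1)) := by
    rw [dispersion_latticeMomentum_eq, hC]; norm_num
  have hE2 : dispersion (latticeMomentum (2 * k) (q - neelIndex (2 * k))) =
      2 + (Real.cos (latticeMomentum (2 * k) q 0) + Real.cos (latticeMomentum (2 * k) q 1)) := by
    rw [dispersion_latticeMomentum_sub_neelIndex k q, hC]; norm_num
  have hpos : 0 < 2 + (Real.cos (latticeMomentum (2 * k) q 0) + Real.cos (latticeMomentum (2 * k) q 1)) := by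
    rw [← hE2]; exact dispersion_latticeMomentum_pos (sub_ne_zero.2 hq)
  have hK : klsDiagKernel 1 (5 / 8) (-(21 / 64)) (2 * k) q =
      Real.cos (latticeMomentum (2 * k) q 0) * Real.cos (latticeMomentum (2 * k) q 1) +
        5 / 8 * ((Real.cos (latticeMomentum (2 * k) q 0) + Real.cos (latticeMomentum (2 * k) q 1)) / 2) +
        -(21 / 64) := by
    rw [klsDiagKernel, hC, one_mul]
  rw [hK, hE1, hE2]
  exact klsMajorant_pointwise (Real.neg_one_le_cos _) (Real.cos_le_one _) (Real.neg_one_le_cos _)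
    (Real.cos_le_one _) (by linarith)

/-! ### The `L`-uniform bound -/

/-- **`𝓦(L) ≤ 𝓦̄ = 39517683/67108864 ≈ 0.58886` for every even side `L = 2k ≥ 8`** (`b = 5/8`, `t = -21/64`).
HONEST FRAMING: ladder R1–R4 with certified numbers; no claim on H/H₀.
[cite: KLS1988JSP, eqs. (4), (6)-(9)] -/
theorem klsDiagRiemannSum_le_uniform (k : ℕ) (hk : 4 ≤ k) :
    klsDiagRiemannSum 1 (5 / 8) (-(21 / 64)) (2 * k) ≤ 39517683/67108864 := by
  haveI : NeZero (2 * k) := ⟨by omega⟩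
  have hL : (0 : ℝ) < (((2 * k : ℕ) : ℝ)) ^ 2 := by positivity
  rw [klsDiagRiemannSum_of_neZero, div_le_iff₀ hL]
  calc ∑ q ∈ (univ : Finset (TorusSite 2 (2 * k))).erase (neelIndex (2 * k)),
        max (-klsDiagKernel 1 (5 / 8) (-(21 / 64)) (2 * k) q) 0 *
          Real.sqrt (dispersion (latticeMomentum (2 * k) q) /
            dispersion (latticeMomentum (2 * k) (q - neelIndex (2 * k))))
      ≤ ∑ q ∈ (univ : Finset (TorusSite 2 (2 * k))).erase (neelIndex (2 * k)),
          klsM (Real.cos (latticeMomentum (2 * k) q 0)) (Real.cos (latticeMomentum (2 * k) q 1)) :=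
        sum_le_sum fun q hq => klsDiag_summand_le k (by omega) q (ne_of_mem_erase hq)
    _ ≤ ∑ q : TorusSite 2 (2 * k),
          klsM (Real.cos (latticeMomentum (2 * k) q 0)) (Real.cos (latticeMomentum (2 * k) q 1)) :=
        sum_le_sum_of_subset_of_nonneg (erase_subset _ _) fun q _ _ =>
          klsM_nonneg (by linarith [Real.neg_one_le_cos (latticeMomentum (2 * k) q 0),
            Real.neg_one_le_cos (latticeMomentum (2 * k) q 1)])
            (by linarith [Real.cos_le_one (latticeMomentum (2 * k) q 0),
              Real.cos_le_one (latticeMomentum (2 * k) q 1)])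
    _ = 39517683/67108864 * (((2 * k : ℕ) : ℝ)) ^ 2 := by rw [sum_klsM (2 * k) (by omega), mul_comm]

/-- **Device D35 (HubbardLadder R2, H₀ line): the diagonal-neighbour correlation of the spin-½
square-lattice Heisenberg antiferromagnet has the Néel sign with an `L`-UNIFORM margin** —
`c_L(1,1) = Re ω(Sᶻ_0 Sᶻ_(1,1)) ≥ 21/256 - 𝓦̄²/5 (= 285532264975191/22517998136852480 ≈ 0.012680)` on EVERY
torus `(ℤ/2kℤ)²`, `2k ≥ 8` (tracial ground-state functional of `Σ_⟨xy⟩ 𝐒_x·𝐒_y`). Kernel theorem generic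
in `L`; the only literature input is the three-sum-rule inequality of Kennedy–Lieb–Shastry with the
`T = 0` infrared bound of Dyson–Lieb–Simon (tree theorem `heisRedCorr2_diag_lower_energyFree`).
HONEST FRAMING: ladder R1–R4 with certified numbers; no claim on H/H₀.
[cite: KLS1988JSP, eqs. (1)-(3), (6)-(9), p. 1023] [cite: DLS1978, Theorem 4.2] -/
theorem heisRedCorr2_diag_lower_uniform_exact (k : ℕ) (hk : 4 ≤ k) :
    (21 : ℝ) / 256 - (39517683/67108864) ^ 2 / 5 ≤ heisRedCorr2 (2 * k) 1 1 1 := by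
  have h := heisRedCorr2_diag_lower_energyFree k (by omega) (b := 5 / 8) (t := -(21 / 64))
    (by norm_num) (by norm_num)
  have hW := klsDiagRiemannSum_le_uniform k hk
  have hW0 := klsDiagRiemannSum_nonneg 1 (5 / 8) (-(21 / 64)) (2 * k)
  nlinarith [mul_le_mul hW hW hW0 (by norm_num)]

/-- **`c_L(1,1) ≥ 0.0126` for every even `L ≥ 8`** (decimal form of
`heisRedCorr2_diag_lower_uniform_exact`). HONEST FRAMING: ladder R1–R4 with certified numbers; no
claim on H/H₀. [cite: KLS1988JSP, eqs. (1)-(3), (6)-(9), p. 1023] [cite: DLS1978, Theorem 4.2] -/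
theorem heisRedCorr2_diag_lower_uniform (k : ℕ) (hk : 4 ≤ k) :
    (63 : ℝ) / 5000 ≤ heisRedCorr2 (2 * k) 1 1 1 := by
  have h := heisRedCorr2_diag_lower_uniform_exact k hk
  norm_num at h ⊢
  linarith

/-- The same bound with the side written as `L` (even, `L ≥ 8`). HONEST FRAMING: ladder R1–R4 with
certified numbers; no claim on H/H₀. [cite: KLS1988JSP, eqs. (1)-(3), (6)-(9), p. 1023] -/
theorem heisRedCorr2_diag_lower_uniform' (L : ℕ) (hL : 8 ≤ L) (hev : Even L) :
    (63 : ℝ) / 5000 ≤ heisRedCorr2 L 1 1 1 := by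
  obtain ⟨k, rfl⟩ := hev
  rw [← two_mul]
  exact heisRedCorr2_diag_lower_uniform k (by omega)

end Summit.HubbardSuperconductivity.HubbardLadder
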